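import Summits.QuantumFields.YangMills.Theorems.UnitScaleTiltProp7CovKernelOneStep
import Summits.QuantumFields.YangMills.Theorems.UnitScaleTiltProp7LeakyLinearTower
import HarnessLib

/-!
# Route `UnitScaleTilt`, crux K1 «MinimiserStabilityRegPr» (stmt-QuantumFields-19200), EX display row (157)-twˢ `hC157`, C-ENTRY line, file F-4a —
# **THE LINEAR TOWER OF A SINGLE FINE BOND AT A CURVED BACKGROUND: `‖(Lin_m δ)(c)‖ ≤ 2·(L·L^{−d})ᵐ·‖δ‖`, SUPPORTED ON THE READERS OF ITS BLOCK**
# ([Balaban1985Averaging] (143)∕(147) p.39–40 «|Q_j(U₀)A| ≤ Q_j|A| + 2C′₁α₀(Lʲη)²Q″_j|A|», here by the leaky linear tower ✓`LeakyLinearTower.leaky_tower_bound_two` over the conjugated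
# flat profile of F-2 ✓`Prop7CovKernelOneStep`: exact tube `e_m` (positive majorant, column mass `(L^{−d})ᵐ`) plus a leak that is geometric toward the bottom, ratio `θ = L⁻²`)

Cell `ym3-torus` (HUMAN RULING D-0037: YM₃ on T³ is ladder rung R3, not the Clay problem), width seat `ym3-torus-px18` gen 3; ★w2-19200 g8 «C-ENTRY GO».  `--supports
stmt-QuantumFields-19200 --as helper`; def-free, 0 sorry; count-neutral.

LETTERS.  `PlaqSmall a₀ U₀` SU(2) background, its tower `Ū₀ˡ = emlIterU l U₀♭`, the field-valued one-step charts `f_l` and their linearisations `T_l := Df_l(0)` (★routeR-w3∕w6 letters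
VERBATIM), the composed linear parts `Lin` of ✓`Prop7CovLogTower.exists_lin` (`Lin 0 = id`, `Lin (l+1) = T_l ∘ Lin l`), ★routeR-w6's cluster axial gauges `û_{l,c}`, the conjugated tube
`T♭_{l,c}` of F-2, `s₀(l) = 30ℓLˡ·2d(3L^{l+1} − 1)a₀`, `c_R(l) = 16(12Lρ)∕ρ²·2s₀(l)`; a fine bond `b₀`, a direction field `δ` vanishing off `b₀`; the reader sets
`S_m := {c′ : c′₋ = x̄_m ∨ c′₊ = x̄_m}`, `x̄_m := iterBlockOf m (b₀)₋`.
§1 `fderiv_apply_eq_zero_of_vanish_reads` (locality of the linearised field chart: a direction vanishing on `Rd(c)` is invisible at `c`), `reads_of_endpoint` (a bond of `S_m` read by `c`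
forces `c ∈ S_{m+1}`), `s0_mul_pow_le` (`s₀(l)·(L²)ⁿ ≤ s₀(l+n)`: the leak is geometric toward the bottom), `conjTube_sub` (linearity of `T♭`).
§2 ★★★ `norm_lin_apply_le_of_plaqSmall` — `2 ≤ L`, `J + 1 ≤ m_P + K_P`, budgets `6400ℓ²Lˡs_B ≤ 1`, `10⁷ℓ²ρ ≤ 1`, `4s₀(l) < ρ` (`l < J`), the F-1 window
`4·(2d·c_R(J−1)·L^{d+1})·(L²)⁻¹ ≤ 1`: **for every `m ≤ J` and `c`, `‖(Lin m δ)(c)‖ ≤ 2·(L·(Lᵈ)⁻¹)ᵐ·‖δ‖`, and `(Lin m δ)(c) = 0` off `S_m`** — the `ha`∕`hSa` letters of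
✓`ChartKernelTower.kernel_tower_bound_le` (`α_m = 2λᵐ‖δ‖`, `λ = L^{1−d}`) at a curved background.
HONEST SCOPE.  Bookkeeping over landed bricks (F-1, F-2, routeR's one-step files); nothing of `hC157`, EX, E′ or the crux is claimed; rung R3, not d = 4; YM gap NOT proved.

References: T. Bałaban, CMP **98** (1985) 17–51 [Balaban1985Averaging] ((87)–(92) p.31, (124)–(127) p.36, (139)–(147) pp.39–40, (161)–(163) p.42); CMP **95** (1984) 17–40
[Balaban1984PropagatorsI] ((1.11), (1.18) pp.19–20).
-/

noncomputable section

open scoped BigOperators Matrix.Norms.L2Operator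
open NormedSpace Metric Set Finset

namespace Summit.QuantumFields.YangMills.Theorems.Prop7CovLinearTowerProfile

open Literature.MathematicalPhysics.QuantumFieldTheory.Balaban1983to89
open T4Continuum BlockAveraging AveragingRT ExpMeanLog LatticeFieldCalculus
open B5Eq118OneStroke (iterBlockOf iterBlockOf_succ iterBlockOf_zero)
open B15DeterminingSets (embIter)
open B7Prop1Explicit (expUnit val_expUnit U1 mem_U1)
open MatrixLog (mlog)
open B10Eq27TorusAxialLog (axialT gaugeActT gaugeActT_apply unitsField toUField suIncl)
open Summit.QuantumFields.YangMills.Theorems.Prop8Chart (emlAvgU emlIterU)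
open Summit.QuantumFields.YangMills.Theorems.Prop7SymAvgTwSym (dbarCovU)
open Summit.QuantumFields.YangMills.Theorems.Prop7TwistedOneStepDefectCov (chart_congr)
open Summit.QuantumFields.YangMills.Theorems.Prop7TwistedOneStepDefectCovGauge (transfUp_toUnits_mem_U1 norm_bgTower_gauged_sub_one_le_of_plaqSmall)
open Summit.QuantumFields.YangMills.Theorems.Prop7TwistedOneStepLinL1OfPlaqSmall (norm_transfUp_toUnits_le_one)
open Summit.QuantumFields.YangMills.Theorems.Prop7TwistedOneStepLinL1 (bondAvg_mono bondAvg_nonneg)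
open Summit.QuantumFields.YangMills.Theorems.Prop7DbarLinCovDefect (differentiableAt_dbarLogRel_zero)
open Summit.QuantumFields.YangMills.Theorems.Prop7CovKernelOneStep (norm_conjTube_le_smul_bondAvg_norm norm_conjTube_le_of_endpoint
  fderiv_chartField_apply_eq_of_plaqSmall norm_fderiv_chartField_apply_sub_conjTube_le_sum_of_plaqSmall)
open Summit.QuantumFields.YangMills.Theorems.ChartKernelTube (bondAvgIter_single_le_mass bondAvg_smul_const bondAvgIter_smul_const card_le_two_mul_d_of_endpoint)
open Summit.QuantumFields.YangMills.Theorems.LeakyLinearTower (leaky_tower_bound_two)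
open Summit.QuantumFields.BalabanUV.T4Continuum (NE9RelativeChartPlaquette.norm_conj_le)

variable {P : Params}

/-! ## §1 Locality, the reader sets, the geometric leak, linearity of the conjugated tube -/

section Letters

variable {j : ℕ} {𝔸 : Type*} [NormedRing 𝔸] [NormedAlgebra ℂ 𝔸] [CompleteSpace 𝔸]

/-- **LOCALITY OF THE LINEARISED ONE-STEP CHART** (any background `V`, any base point where the chart is differentiable): a direction `w` vanishing on the read set `Rd(c)` is
invisible — `Df_V(·)(c)(0)[w] = 0` (the chart factors through the truncation to `Rd(c)`, ✓`chart_congr`). [cite: Balaban1985Averaging, (87)–(92) p.31] -/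
theorem fderiv_apply_eq_zero_of_vanish_reads (hj : j + 1 ≤ P.m + P.K) (V : GaugeField P j 𝔸ˣ) (c : PBond P (j + 1))
    (hd : DifferentiableAt ℂ (fun y : PBond P j → 𝔸 =>
      mlog (((dbarCovU V (fun b => expUnit (y b) * V b) c : 𝔸ˣ) : 𝔸) * (((emlAvgU V c)⁻¹ : 𝔸ˣ) : 𝔸))) 0)
    {w : PBond P j → 𝔸} (hw : ∀ b : PBond P j, (blockOf b.src = c.src ∨ blockOf b.src = c.tgt) → (blockOf b.tgt = c.src ∨ blockOf b.tgt = c.tgt) → w b = 0) :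
    fderiv ℂ (fun y : PBond P j → 𝔸 =>
      mlog (((dbarCovU V (fun b => expUnit (y b) * V b) c : 𝔸ˣ) : 𝔸) * (((emlAvgU V c)⁻¹ : 𝔸ˣ) : 𝔸))) 0 w = 0 := by
  classical
  set G : (PBond P j → 𝔸) → 𝔸 := fun y => mlog (((dbarCovU V (fun b => expUnit (y b) * V b) c : 𝔸ˣ) : 𝔸) * (((emlAvgU V c)⁻¹ : 𝔸ˣ) : 𝔸)) with hG
  set TB : PBond P j → Prop := fun b => (blockOf b.src = c.src ∨ blockOf b.src = c.tgt) ∧ (blockOf b.tgt = c.src ∨ blockOf b.tgt = c.tgt) with hTB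
  set π : (PBond P j → 𝔸) →L[ℂ] (PBond P j → 𝔸) :=
    ContinuousLinearMap.pi fun b : PBond P j => if TB b then ContinuousLinearMap.proj (R := ℂ) (φ := fun _ : PBond P j => 𝔸) b else 0 with hπ
  have hπ_apply : ∀ (A : PBond P j → 𝔸) (b : PBond P j), π A b = if TB b then A b else 0 := by
    intro A b
    simp only [hπ, ContinuousLinearMap.pi_apply]
    split_ifs <;> rfl
  have hGπ : (G ∘ ⇑π) = G := by
    funext A
    show G (π A) = G A
    exact chart_congr hj V c fun b h1 h2 => by rw [hπ_apply, if_pos (show TB b from ⟨h1, h2⟩)]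
  have hπ0 : π 0 = 0 := map_zero π
  have hπw : π w = 0 := by
    funext b; rw [hπ_apply]; split_ifs with hb
    · exact hw b hb.1 hb.2
    · rfl
  have hd' : DifferentiableAt ℂ G (π 0) := by rw [hπ0]; exact hd
  have hchain : fderiv ℂ (G ∘ ⇑π) 0 = (fderiv ℂ G (π 0)).comp (fderiv ℂ (⇑π) 0) := fderiv_comp 0 hd' π.differentiableAt
  rw [hGπ, π.fderiv, hπ0] at hchain
  show fderiv ℂ G 0 w = 0
  rw [hchain, ContinuousLinearMap.comp_apply, hπw, map_zero]

omit [NormedAlgebra ℂ 𝔸] [CompleteSpace 𝔸] in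
/-- **A READER OF `x̄` READ BY `c` PUTS `blockOf x̄` AMONG THE ENDS OF `c`.** [cite: Balaban1984PropagatorsI, (1.18) p.20] -/
theorem reads_of_endpoint (c : PBond P (j + 1)) (b : PBond P j) (x : Site P j) (hb : b.src = x ∨ b.tgt = x)
    (h1 : blockOf b.src = c.src ∨ blockOf b.src = c.tgt) (h2 : blockOf b.tgt = c.src ∨ blockOf b.tgt = c.tgt) :
    c.src = blockOf x ∨ c.tgt = blockOf x := by
  rcases hb with h | h
  · rw [← h]; rcases h1 with h1 | h1
    · exact Or.inl h1.symm
    · exact Or.inr h1.symm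
  · rw [← h]; rcases h2 with h2 | h2
    · exact Or.inl h2.symm
    · exact Or.inr h2.symm

end Letters

/-- **THE LEAK IS GEOMETRIC TOWARD THE BOTTOM**: `s₀(l)·(L²)ⁿ ≤ s₀(l + n)` (`1 ≤ L`, `0 ≤ a₀`). [cite: Balaban1985Averaging, (52) p.25, (143) p.39] -/
theorem s0_mul_pow_le (hL1 : (1 : ℝ) ≤ P.L) {a₀ : ℝ} (ha₀ : 0 ≤ a₀) (l : ℕ) : ∀ n : ℕ,
    (30 * (((P.d + 2) * P.L : ℕ) : ℝ) * (P.L : ℝ) ^ l * (2 * ((P.d : ℝ) * (3 * (P.L : ℝ) ^ (l + 1) - 1)) * a₀)) * ((P.L : ℝ) ^ 2) ^ n ≤ (30 * (((P.d + 2) * P.L : ℕ) : ℝ) * (P.L : ℝ) ^ (l + n) * (2 * ((P.d : ℝ) * (3 * (P.L : ℝ) ^ ((l + n) + 1) - 1)) * a₀)) := by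
  intro n
  induction n with
  | zero => simp
  | succ n ih =>
    have hstep : (30 * (((P.d + 2) * P.L : ℕ) : ℝ) * (P.L : ℝ) ^ (l + n) * (2 * ((P.d : ℝ) * (3 * (P.L : ℝ) ^ ((l + n) + 1) - 1)) * a₀)) * (P.L : ℝ) ^ 2 ≤ (30 * (((P.d + 2) * P.L : ℕ) : ℝ) * (P.L : ℝ) ^ (l + (n + 1)) * (2 * ((P.d : ℝ) * (3 * (P.L : ℝ) ^ ((l + (n + 1)) + 1) - 1)) * a₀)) := by
      rw [show l + (n + 1) = (l + n) + 1 by ring]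
      have hk : ∀ k : ℕ, (P.L : ℝ) ^ k * (3 * (P.L : ℝ) ^ (k + 1) - 1) * (P.L : ℝ) ^ 2 ≤ (P.L : ℝ) ^ (k + 1) * (3 * (P.L : ℝ) ^ (k + 1 + 1) - 1) := by
        intro k
        have hLk : (0 : ℝ) ≤ (P.L : ℝ) ^ (k + 1) := by positivity
        have e1 : (P.L : ℝ) ^ k * (3 * (P.L : ℝ) ^ (k + 1) - 1) * (P.L : ℝ) ^ 2 = 3 * (P.L : ℝ) ^ (k + 1) * (P.L : ℝ) ^ (k + 1 + 1) - (P.L : ℝ) ^ (k + 1) * P.L := by ring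
        have e2 : (P.L : ℝ) ^ (k + 1) * (3 * (P.L : ℝ) ^ (k + 1 + 1) - 1) = 3 * (P.L : ℝ) ^ (k + 1) * (P.L : ℝ) ^ (k + 1 + 1) - (P.L : ℝ) ^ (k + 1) := by ring
        rw [e1, e2]
        nlinarith
      have hc : (0 : ℝ) ≤ 30 * (((P.d + 2) * P.L : ℕ) : ℝ) * (2 * (P.d : ℝ)) * a₀ := by positivity
      have := mul_le_mul_of_nonneg_left (hk (l + n)) hc
      have e3 : ∀ k : ℕ, (30 * (((P.d + 2) * P.L : ℕ) : ℝ) * (P.L : ℝ) ^ k * (2 * ((P.d : ℝ) * (3 * (P.L : ℝ) ^ (k + 1) - 1)) * a₀)) = 30 * (((P.d + 2) * P.L : ℕ) : ℝ) * (2 * (P.d : ℝ)) * a₀ * ((P.L : ℝ) ^ k * (3 * (P.L : ℝ) ^ (k + 1) - 1)) := fun k => by ring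
      rw [e3, e3]
      nlinarith
    calc (30 * (((P.d + 2) * P.L : ℕ) : ℝ) * (P.L : ℝ) ^ l * (2 * ((P.d : ℝ) * (3 * (P.L : ℝ) ^ (l + 1) - 1)) * a₀)) * ((P.L : ℝ) ^ 2) ^ (n + 1) = ((30 * (((P.d + 2) * P.L : ℕ) : ℝ) * (P.L : ℝ) ^ l * (2 * ((P.d : ℝ) * (3 * (P.L : ℝ) ^ (l + 1) - 1)) * a₀)) * ((P.L : ℝ) ^ 2) ^ n) * (P.L : ℝ) ^ 2 := by ring
      _ ≤ (30 * (((P.d + 2) * P.L : ℕ) : ℝ) * (P.L : ℝ) ^ (l + n) * (2 * ((P.d : ℝ) * (3 * (P.L : ℝ) ^ ((l + n) + 1) - 1)) * a₀)) * (P.L : ℝ) ^ 2 := mul_le_mul_of_nonneg_right ih (by positivity)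
      _ ≤ _ := hstep

/-! ## §2 Linearity of the conjugated tube; the linear tower of a single bond -/

section SU2

/-- **THE CONJUGATED TUBE IS ADDITIVE** (`Q` is linear, the conjugations are linear). [cite: Balaban1984PropagatorsI, (1.11) p.19] -/
theorem conjTube_sub {j : ℕ} (u : GaugeTransf P j (Matrix (Fin 2) (Fin 2) ℂ)ˣ) (x : Site P j) (w w' : PBond P j → Matrix (Fin 2) (Fin 2) ℂ) (c : PBond P (j + 1)) :
    (((u x)⁻¹ : (Matrix (Fin 2) (Fin 2) ℂ)ˣ) : Matrix (Fin 2) (Fin 2) ℂ) *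
        (((P.L : ℕ) : ℂ) • bondAvg (fun b : PBond P j => ((u b.src : (Matrix (Fin 2) (Fin 2) ℂ)ˣ) : Matrix (Fin 2) (Fin 2) ℂ) * (w b - w' b) * (((u b.src)⁻¹ : (Matrix (Fin 2) (Fin 2) ℂ)ˣ) : Matrix (Fin 2) (Fin 2) ℂ)) c) *
        ((u x : (Matrix (Fin 2) (Fin 2) ℂ)ˣ) : Matrix (Fin 2) (Fin 2) ℂ) =
      (((u x)⁻¹ : (Matrix (Fin 2) (Fin 2) ℂ)ˣ) : Matrix (Fin 2) (Fin 2) ℂ) *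
          (((P.L : ℕ) : ℂ) • bondAvg (fun b : PBond P j => ((u b.src : (Matrix (Fin 2) (Fin 2) ℂ)ˣ) : Matrix (Fin 2) (Fin 2) ℂ) * w b * (((u b.src)⁻¹ : (Matrix (Fin 2) (Fin 2) ℂ)ˣ) : Matrix (Fin 2) (Fin 2) ℂ)) c) *
          ((u x : (Matrix (Fin 2) (Fin 2) ℂ)ˣ) : Matrix (Fin 2) (Fin 2) ℂ) -
        (((u x)⁻¹ : (Matrix (Fin 2) (Fin 2) ℂ)ˣ) : Matrix (Fin 2) (Fin 2) ℂ) *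
          (((P.L : ℕ) : ℂ) • bondAvg (fun b : PBond P j => ((u b.src : (Matrix (Fin 2) (Fin 2) ℂ)ˣ) : Matrix (Fin 2) (Fin 2) ℂ) * w' b * (((u b.src)⁻¹ : (Matrix (Fin 2) (Fin 2) ℂ)ˣ) : Matrix (Fin 2) (Fin 2) ℂ)) c) *
          ((u x : (Matrix (Fin 2) (Fin 2) ℂ)ˣ) : Matrix (Fin 2) (Fin 2) ℂ) := by
  have hfun : (fun b : PBond P j => ((u b.src : (Matrix (Fin 2) (Fin 2) ℂ)ˣ) : Matrix (Fin 2) (Fin 2) ℂ) * (w b - w' b) * (((u b.src)⁻¹ : (Matrix (Fin 2) (Fin 2) ℂ)ˣ) : Matrix (Fin 2) (Fin 2) ℂ)) =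
      fun b => ((u b.src : (Matrix (Fin 2) (Fin 2) ℂ)ˣ) : Matrix (Fin 2) (Fin 2) ℂ) * w b * (((u b.src)⁻¹ : (Matrix (Fin 2) (Fin 2) ℂ)ˣ) : Matrix (Fin 2) (Fin 2) ℂ) -
        ((u b.src : (Matrix (Fin 2) (Fin 2) ℂ)ˣ) : Matrix (Fin 2) (Fin 2) ℂ) * w' b * (((u b.src)⁻¹ : (Matrix (Fin 2) (Fin 2) ℂ)ˣ) : Matrix (Fin 2) (Fin 2) ℂ) := by
    funext b; noncomm_ring
  rw [hfun, B5Eq112RenormTransf.bondAvg_sub, Pi.sub_apply, smul_sub, mul_sub, sub_mul]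

/-- ★★★ **THE LINEAR TOWER OF A SINGLE FINE BOND AT A CURVED BACKGROUND.**  `2 ≤ L`, `J + 1 ≤ m_P + K_P`, `PlaqSmall a₀ U₀`, budgets `6400ℓ²Lˡs_B ≤ 1`, `10⁷ℓ²ρ ≤ 1`,
`4s₀(l) < ρ` (`l < J`), the F-1 window `4·(2d·c_R(J−1)·L^{d+1})·(L²)⁻¹ ≤ 1`; `Lin` the composed linearisations (✓`exists_lin` letters), `δ` vanishing off the fine bond `b₀`.  Then for
every `m ≤ J`: **`‖(Lin m δ)(c)‖ ≤ 2·(L·(Lᵈ)⁻¹)ᵐ·‖δ‖` for all `c`, and `(Lin m δ)(c) = 0` unless `c₋ = x̄_m ∨ c₊ = x̄_m`**, `x̄_m := iterBlockOf m (b₀)₋` — the `ha`∕`hSa` letters of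
✓`ChartKernelTower.kernel_tower_bound_le` (`α_m = 2λᵐ‖δ‖`, `λ = L^{1−d}`), by ✓`leaky_tower_bound_two` over the conjugated flat profile `‖e_m(c)‖ ≤ Lᵐ(Q_m|δ|)(c) ≤ λᵐ‖δ‖`.
[cite: Balaban1985Averaging, (139)-(147) pp.39-40; Balaban1984PropagatorsI, (1.18) p.20] -/
theorem norm_lin_apply_le_of_plaqSmall (hL2 : 2 ≤ P.L) {J : ℕ} (hJ : J + 1 ≤ P.m + P.K) (U₀ : GaugeField P 0 (Matrix.specialUnitaryGroup (Fin 2) ℂ))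
    {a₀ : ℝ} (ha₀ : 0 < a₀) (hU : PlaqSmall a₀ U₀)
    (hbud₀ : ∀ l, l < J → 6400 * (((P.d + 2) * P.L : ℕ) : ℝ) ^ 2 * (P.L : ℝ) ^ l * (2 * ((P.d : ℝ) * (3 * (P.L : ℝ) ^ (l + 1) - 1)) * a₀) ≤ 1)
    {ρ : ℝ} (hρ0 : 0 < ρ) (hbudget : 10000000 * (((P.d + 2) * P.L : ℕ) : ℝ) ^ 2 * ρ ≤ 1)
    (hs₀ρ : ∀ l, l < J → 4 * (30 * (((P.d + 2) * P.L : ℕ) : ℝ) * (P.L : ℝ) ^ l * (2 * ((P.d : ℝ) * (3 * (P.L : ℝ) ^ (l + 1) - 1)) * a₀)) < ρ)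
    (hg : 4 * (2 * (P.d : ℝ) * (16 * (12 * (P.L : ℝ) * ρ) / ρ ^ 2 * (2 * (30 * (((P.d + 2) * P.L : ℕ) : ℝ) * (P.L : ℝ) ^ (J - 1) * (2 * ((P.d : ℝ) * (3 * (P.L : ℝ) ^ ((J - 1) + 1) - 1)) * a₀)))) * (P.L : ℝ) ^ (P.d + 1)) * ((P.L : ℝ) ^ 2)⁻¹ ≤ 1)
    (Lin : (m : ℕ) → (PBond P 0 → Matrix (Fin 2) (Fin 2) ℂ) →L[ℂ] (PBond P m → Matrix (Fin 2) (Fin 2) ℂ)) (hLin0 : Lin 0 = ContinuousLinearMap.id ℂ (PBond P 0 → Matrix (Fin 2) (Fin 2) ℂ))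
    (hLins : ∀ l : ℕ, Lin (l + 1) = (fderiv ℂ (fun (y : PBond P l → Matrix (Fin 2) (Fin 2) ℂ) (c : PBond P (l + 1)) =>
          mlog (((dbarCovU (emlIterU l (unitsField (toUField U₀))) (fun b => expUnit (y b) * emlIterU l (unitsField (toUField U₀)) b) c :
              (Matrix (Fin 2) (Fin 2) ℂ)ˣ) : Matrix (Fin 2) (Fin 2) ℂ) *
            (((emlAvgU (emlIterU l (unitsField (toUField U₀))) c)⁻¹ : (Matrix (Fin 2) (Fin 2) ℂ)ˣ) : Matrix (Fin 2) (Fin 2) ℂ))) 0).comp (Lin l))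
    (b₀ : PBond P 0) (δ : PBond P 0 → Matrix (Fin 2) (Fin 2) ℂ) (hδ : ∀ b, b ≠ b₀ → δ b = 0) :
    ∀ m, m ≤ J → (∀ c : PBond P m, ‖Lin m δ c‖ ≤ 2 * (((P.L : ℝ) * ((P.L : ℝ) ^ P.d)⁻¹) ^ m * ‖δ‖)) ∧
      (∀ c : PBond P m, ¬ (c.src = iterBlockOf m b₀.src ∨ c.tgt = iterBlockOf m b₀.src) → Lin m δ c = 0) := by
  classical
  have hL1 : (1 : ℝ) ≤ P.L := by exact_mod_cast P.L_pos
  have hL2r : (2 : ℝ) ≤ P.L := by exact_mod_cast hL2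
  have hs₀0 : ∀ l : ℕ, 0 ≤ (30 * (((P.d + 2) * P.L : ℕ) : ℝ) * (P.L : ℝ) ^ l * (2 * ((P.d : ℝ) * (3 * (P.L : ℝ) ^ (l + 1) - 1)) * a₀)) := by
    intro l
    have h3 : (0 : ℝ) ≤ 3 * (P.L : ℝ) ^ (l + 1) - 1 := by linarith [one_le_pow₀ (n := l + 1) hL1]
    have ha := ha₀.le
    positivity
  have hcR0 : ∀ l : ℕ, 0 ≤ (16 * (12 * (P.L : ℝ) * ρ) / ρ ^ 2 * (2 * (30 * (((P.d + 2) * P.L : ℕ) : ℝ) * (P.L : ℝ) ^ l * (2 * ((P.d : ℝ) * (3 * (P.L : ℝ) ^ (l + 1) - 1)) * a₀)))) := fun l => by have := hs₀0 l; positivity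
  -- unitarity of the cluster gauges
  have hû1 : ∀ (l : ℕ) (c : PBond P (l + 1)) (x : Site P l), ‖(((transfUp (fun x => Unitary.toUnits (suIncl (axialT U₀ (embIter (l + 1) c.src) x)) : GaugeTransf P 0 (Matrix (Fin 2) (Fin 2) ℂ)ˣ) l) x : (Matrix (Fin 2) (Fin 2) ℂ)ˣ) : Matrix (Fin 2) (Fin 2) ℂ)‖ ≤ 1 := fun l c x => (norm_transfUp_toUnits_le_one _ l x).1
  have hû2 : ∀ (l : ℕ) (c : PBond P (l + 1)) (x : Site P l), ‖((((transfUp (fun x => Unitary.toUnits (suIncl (axialT U₀ (embIter (l + 1) c.src) x)) : GaugeTransf P 0 (Matrix (Fin 2) (Fin 2) ℂ)ˣ) l) x)⁻¹ : (Matrix (Fin 2) (Fin 2) ℂ)ˣ) : Matrix (Fin 2) (Fin 2) ℂ)‖ ≤ 1 := fun l c x => (norm_transfUp_toUnits_le_one _ l x).2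
  -- the letters of the leaky linear tower
  set lam : ℝ := (P.L : ℝ) * ((P.L : ℝ) ^ P.d)⁻¹ with hlam
  set Tf : (l : ℕ) → (PBond P l → Matrix (Fin 2) (Fin 2) ℂ) → PBond P (l + 1) → Matrix (Fin 2) (Fin 2) ℂ := fun l w c =>
    ((((transfUp (fun x => Unitary.toUnits (suIncl (axialT U₀ (embIter (l + 1) c.src) x)) : GaugeTransf P 0 (Matrix (Fin 2) (Fin 2) ℂ)ˣ) l) (emb c.src))⁻¹ : (Matrix (Fin 2) (Fin 2) ℂ)ˣ) : Matrix (Fin 2) (Fin 2) ℂ) *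
            (((P.L : ℕ) : ℂ) • bondAvg (fun b : PBond P l => (((transfUp (fun x => Unitary.toUnits (suIncl (axialT U₀ (embIter (l + 1) c.src) x)) : GaugeTransf P 0 (Matrix (Fin 2) (Fin 2) ℂ)ˣ) l) b.src : (Matrix (Fin 2) (Fin 2) ℂ)ˣ) : Matrix (Fin 2) (Fin 2) ℂ) * w b * ((((transfUp (fun x => Unitary.toUnits (suIncl (axialT U₀ (embIter (l + 1) c.src) x)) : GaugeTransf P 0 (Matrix (Fin 2) (Fin 2) ℂ)ˣ) l) b.src)⁻¹ : (Matrix (Fin 2) (Fin 2) ℂ)ˣ) : Matrix (Fin 2) (Fin 2) ℂ)) c) *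
            (((transfUp (fun x => Unitary.toUnits (suIncl (axialT U₀ (embIter (l + 1) c.src) x)) : GaugeTransf P 0 (Matrix (Fin 2) (Fin 2) ℂ)ˣ) l) (emb c.src) : (Matrix (Fin 2) (Fin 2) ℂ)ˣ) : Matrix (Fin 2) (Fin 2) ℂ) with hTf
  set T : (l : ℕ) → (PBond P l → Matrix (Fin 2) (Fin 2) ℂ) → PBond P (l + 1) → Matrix (Fin 2) (Fin 2) ℂ := fun l w c => (fderiv ℂ (fun (y : PBond P l → Matrix (Fin 2) (Fin 2) ℂ) (c : PBond P (l + 1)) =>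
          mlog (((dbarCovU (emlIterU l (unitsField (toUField U₀))) (fun b => expUnit (y b) * emlIterU l (unitsField (toUField U₀)) b) c :
              (Matrix (Fin 2) (Fin 2) ℂ)ˣ) : Matrix (Fin 2) (Fin 2) ℂ) *
            (((emlAvgU (emlIterU l (unitsField (toUField U₀))) c)⁻¹ : (Matrix (Fin 2) (Fin 2) ℂ)ˣ) : Matrix (Fin 2) (Fin 2) ℂ))) 0 w) c with hT
  set R : (l : ℕ) → (PBond P l → Matrix (Fin 2) (Fin 2) ℂ) → PBond P (l + 1) → Matrix (Fin 2) (Fin 2) ℂ := fun l w c => T l w c - Tf l w c with hR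
  obtain ⟨e, he0, hes⟩ : ∃ e : (m : ℕ) → PBond P m → Matrix (Fin 2) (Fin 2) ℂ, e 0 = δ ∧ ∀ m, e (m + 1) = fun c => Tf m (e m) c :=
    ⟨fun m => Nat.rec (motive := fun m => PBond P m → Matrix (Fin 2) (Fin 2) ℂ) δ (fun m em => fun c => Tf m em c) m, rfl, fun _ => rfl⟩
  set a : (m : ℕ) → PBond P m → Matrix (Fin 2) (Fin 2) ℂ := fun m => Lin m δ with ha
  set r : (m : ℕ) → PBond P m → Matrix (Fin 2) (Fin 2) ℂ := fun m c => a m c - e m c with hr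
  set S : (m : ℕ) → Finset (PBond P m) := fun m => univ.filter fun c : PBond P m => c.src = iterBlockOf m b₀.src ∨ c.tgt = iterBlockOf m b₀.src with hS
  have hSmem : ∀ (m : ℕ) (c : PBond P m), c ∈ S m ↔ (c.src = iterBlockOf m b₀.src ∨ c.tgt = iterBlockOf m b₀.src) := fun m c => by
    rw [hS, Finset.mem_filter]; exact ⟨fun h => h.2, fun h => ⟨Finset.mem_univ _, h⟩⟩
  have hSend : ∀ m, ∀ c' ∈ S m, c'.src = iterBlockOf m b₀.src ∨ c'.tgt = iterBlockOf m b₀.src := fun m c' hc' => (hSmem m c').1 hc'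
  -- a reader of level `m` supported on `S m`, read by `c ∉ S (m+1)`, is invisible: the read set of `c` misses `S m`
  have hmiss : ∀ (m : ℕ) (c : PBond P (m + 1)), c ∉ S (m + 1) → ∀ b : PBond P m,
      (blockOf b.src = c.src ∨ blockOf b.src = c.tgt) → (blockOf b.tgt = c.src ∨ blockOf b.tgt = c.tgt) → b ∉ S m := by
    intro m c hc b h1 h2 hb
    apply hc
    rw [hSmem, iterBlockOf_succ]
    exact reads_of_endpoint c b _ ((hSmem m b).1 hb) h1 h2
  -- a₀, recursion of a
  have ha0 : a 0 = δ := by show Lin 0 δ = δ; rw [hLin0]; rfl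
  have has : ∀ (m : ℕ) (c : PBond P (m + 1)), a (m + 1) c = T m (a m) c := by
    intro m c; show Lin (m + 1) δ c = _; rw [hLins m]; rfl
  -- differentiability at `0` of the component charts (for the locality of `T`)
  have hdiff0 : ∀ l, l < J → ∀ c : PBond P (l + 1), DifferentiableAt ℂ (fun (y : PBond P l → Matrix (Fin 2) (Fin 2) ℂ) =>
          mlog (((dbarCovU (emlIterU l (unitsField (toUField U₀))) (fun b => expUnit (y b) * emlIterU l (unitsField (toUField U₀)) b) c :
              (Matrix (Fin 2) (Fin 2) ℂ)ˣ) : Matrix (Fin 2) (Fin 2) ℂ) *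
            (((emlAvgU (emlIterU l (unitsField (toUField U₀))) c)⁻¹ : (Matrix (Fin 2) (Fin 2) ℂ)ˣ) : Matrix (Fin 2) (Fin 2) ℂ))) 0 := by
    intro l hl c
    exact (differentiableAt_dbarLogRel_zero (by omega) c _ (transfUp (fun x => Unitary.toUnits (suIncl (axialT U₀ (embIter (l + 1) c.src) x)) : GaugeTransf P 0 (Matrix (Fin 2) (Fin 2) ℂ)ˣ) l) (hû1 l c) (hû2 l c) hρ0 hbudget (hs₀0 l) (hs₀ρ l hl)
      (norm_bgTower_gauged_sub_one_le_of_plaqSmall (by omega) U₀ ha₀ hU (hbud₀ l hl) c)).1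
  have hTloc : ∀ l, l < J → ∀ (c : PBond P (l + 1)) (w : PBond P l → Matrix (Fin 2) (Fin 2) ℂ),
      (∀ b : PBond P l, (blockOf b.src = c.src ∨ blockOf b.src = c.tgt) → (blockOf b.tgt = c.src ∨ blockOf b.tgt = c.tgt) → w b = 0) → T l w c = 0 := by
    intro l hl c w hw
    show (fderiv ℂ (fun (y : PBond P l → Matrix (Fin 2) (Fin 2) ℂ) (c : PBond P (l + 1)) =>
          mlog (((dbarCovU (emlIterU l (unitsField (toUField U₀))) (fun b => expUnit (y b) * emlIterU l (unitsField (toUField U₀)) b) c :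
              (Matrix (Fin 2) (Fin 2) ℂ)ˣ) : Matrix (Fin 2) (Fin 2) ℂ) *
            (((emlAvgU (emlIterU l (unitsField (toUField U₀))) c)⁻¹ : (Matrix (Fin 2) (Fin 2) ℂ)ˣ) : Matrix (Fin 2) (Fin 2) ℂ))) 0 w) c = 0
    rw [fderiv_chartField_apply_eq_of_plaqSmall (by omega) U₀ ha₀ hU (hbud₀ l hl) hρ0 hbudget (hs₀ρ l hl) w c]
    exact fderiv_apply_eq_zero_of_vanish_reads (by omega) _ c (hdiff0 l hl c) hw
  -- supports
  have hSδ : ∀ c', c' ∉ S 0 → δ c' = 0 := by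
    intro c' hc'
    refine hδ c' fun h => hc' ?_
    rw [hSmem, iterBlockOf_zero, h]; exact Or.inl rfl
  have hSa : ∀ m, m ≤ J → ∀ c', c' ∉ S m → a m c' = 0 := by
    intro m
    induction m with
    | zero => intro _ c' hc'; rw [ha0]; exact hSδ c' hc'
    | succ m ih =>
      intro hm c' hc'
      have hm' : m < J := Nat.lt_of_succ_le hm
      rw [has]
      exact hTloc m hm' c' (a m) fun b h1 h2 => ih hm'.le b (hmiss m c' hc' b h1 h2)
  have hSe : ∀ m, m ≤ J → ∀ c', c' ∉ S m → e m c' = 0 := by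
    intro m
    induction m with
    | zero => intro _ c' hc'; rw [he0]; exact hSδ c' hc'
    | succ m ih =>
      intro hm c' hc'
      have hm' : m < J := Nat.lt_of_succ_le hm
      rw [hes m]
      show Tf m (e m) c' = 0
      have hQ : bondAvg (fun b : PBond P m => (((transfUp (fun x => Unitary.toUnits (suIncl (axialT U₀ (embIter (m + 1) c'.src) x)) : GaugeTransf P 0 (Matrix (Fin 2) (Fin 2) ℂ)ˣ) m) b.src : (Matrix (Fin 2) (Fin 2) ℂ)ˣ) : Matrix (Fin 2) (Fin 2) ℂ) * e m b *
          ((((transfUp (fun x => Unitary.toUnits (suIncl (axialT U₀ (embIter (m + 1) c'.src) x)) : GaugeTransf P 0 (Matrix (Fin 2) (Fin 2) ℂ)ˣ) m) b.src)⁻¹ : (Matrix (Fin 2) (Fin 2) ℂ)ˣ) : Matrix (Fin 2) (Fin 2) ℂ)) c' = 0 :=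
        B5AveragingLocalityV1.bondAvg_eq_zero_of_local (by omega) _ c' fun b h1 h2 => by
          rw [ih hm'.le b (hmiss m c' hc' b h1 h2), mul_zero, zero_mul]
      simp only [hTf]
      rw [hQ, smul_zero, mul_zero, zero_mul]
  have hSr : ∀ m, m ≤ J → ∀ c', c' ∉ S m → r m c' = 0 := fun m hm c' hc' => by
    show a m c' - e m c' = 0; rw [hSa m hm c' hc', hSe m hm c' hc', sub_zero]
  -- the conjugated flat profile
  have hprof : ∀ m, m ≤ J → ∀ c, ‖e m c‖ ≤ (P.L : ℝ) ^ m * bondAvgIter m (fun b => ‖δ b‖) c := by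
    intro m
    induction m with
    | zero => intro _ c; rw [he0, pow_zero, one_mul]; exact le_rfl
    | succ m ih =>
      intro hm c
      have hm' : m < J := Nat.lt_of_succ_le hm
      rw [hes m]
      show ‖Tf m (e m) c‖ ≤ _
      have h1 := norm_conjTube_le_smul_bondAvg_norm (transfUp (fun x => Unitary.toUnits (suIncl (axialT U₀ (embIter (m + 1) c.src) x)) : GaugeTransf P 0 (Matrix (Fin 2) (Fin 2) ℂ)ˣ) m) (hû1 m c) (hû2 m c) (emb c.src) (e m) c
      refine h1.trans ?_
      have h2 : bondAvg (fun b => ‖e m b‖) c ≤ bondAvg (fun b => (P.L : ℝ) ^ m * bondAvgIter m (fun b => ‖δ b‖) b) c := bondAvg_mono (ih hm'.le) c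
      have hcm : bondAvg (fun b => (P.L : ℝ) ^ m * bondAvgIter m (fun b => ‖δ b‖) b) c = (P.L : ℝ) ^ m * bondAvg (bondAvgIter m (fun b => ‖δ b‖)) c := by
        have hb := bondAvg_smul_const (V := ℝ) (bondAvgIter m (fun b => ‖δ b‖)) ((P.L : ℝ) ^ m) c
        rw [smul_eq_mul, mul_comm] at hb
        rw [← hb]
        exact congrArg (fun Y => bondAvg Y c) (funext fun b => by rw [smul_eq_mul, mul_comm])
      rw [hcm] at h2
      calc (P.L : ℝ) * bondAvg (fun b => ‖e m b‖) c ≤ (P.L : ℝ) * ((P.L : ℝ) ^ m * bondAvg (bondAvgIter m (fun b => ‖δ b‖)) c) :=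
            mul_le_mul_of_nonneg_left h2 (by positivity)
        _ = (P.L : ℝ) ^ (m + 1) * bondAvgIter (m + 1) (fun b => ‖δ b‖) c := by rw [pow_succ]; show _ = _ * bondAvg (bondAvgIter m _) c; ring
  have he' : ∀ m, m ≤ J → ∀ c, ‖e m c‖ ≤ lam ^ m * ‖δ‖ := by
    intro m hm c
    refine (hprof m hm c).trans ?_
    have hX : (fun b : PBond P 0 => ‖δ b‖) = fun b => (Pi.single b₀ (1 : ℝ) : PBond P 0 → ℝ) b • ‖δ b₀‖ := by
      funext b
      by_cases hb : b = b₀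
      · subst hb; simp
      · rw [hδ b hb, Pi.single_eq_of_ne hb, norm_zero, zero_smul]
    rw [hX, bondAvgIter_smul_const, smul_eq_mul]
    have hmass := bondAvgIter_single_le_mass (P := P) (by omega : m ≤ P.m + P.K) b₀ c
    have hδ0 : ‖δ b₀‖ ≤ ‖δ‖ := norm_le_pi_norm δ b₀
    have hnn : 0 ≤ bondAvgIter m (Pi.single b₀ (1 : ℝ)) c := B8Prop3MultiLevelTorus.bondAvgIter_single_nonneg m b₀ c
    calc (P.L : ℝ) ^ m * (bondAvgIter m (Pi.single b₀ (1 : ℝ)) c * ‖δ b₀‖) ≤ (P.L : ℝ) ^ m * ((((P.L : ℝ) ^ P.d)⁻¹) ^ m * ‖δ‖) := by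
          refine mul_le_mul_of_nonneg_left ?_ (by positivity)
          exact mul_le_mul hmass hδ0 (norm_nonneg _) (by positivity)
      _ = lam ^ m * ‖δ‖ := by rw [hlam, mul_pow]; ring
  -- the leaky linear tower
  have hmain := leaky_tower_bound_two J (fun m => PBond P m) a e r Tf R S (fun l => (16 * (12 * (P.L : ℝ) * ρ) / ρ ^ 2 * (2 * (30 * (((P.d + 2) * P.L : ℕ) : ℝ) * (P.L : ℝ) ^ l * (2 * ((P.d : ℝ) * (3 * (P.L : ℝ) ^ (l + 1) - 1)) * a₀)))))
    (Θ := 2) (θ := ((P.L : ℝ) ^ 2)⁻¹) (g := 2 * (P.d : ℝ) * (16 * (12 * (P.L : ℝ) * ρ) / ρ ^ 2 * (2 * (30 * (((P.d + 2) * P.L : ℕ) : ℝ) * (P.L : ℝ) ^ (J - 1) * (2 * ((P.d : ℝ) * (3 * (P.L : ℝ) ^ ((J - 1) + 1) - 1)) * a₀)))) * (P.L : ℝ) ^ (P.d + 1)) (lam := lam) (α₀ := ‖δ‖) (ν := 2 * P.d)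
    (by norm_num) (by positivity) (inv_le_one_of_one_le₀ (by nlinarith)) (by have := hcR0 (J - 1); positivity) (by positivity) (norm_nonneg _)
    (by rw [show (2 : ℝ) * ((P.L : ℝ) ^ 2)⁻¹ = 2 / (P.L : ℝ) ^ 2 from (div_eq_mul_inv _ _).symm, div_le_div_iff₀ (by positivity) (by norm_num)]; nlinarith)
    hg (fun m _ => hcR0 m) ?_ (fun m c => by show a m c = e m c + (a m c - e m c); abel) (fun c => by show a 0 c - e 0 c = 0; rw [ha0, he0, sub_self])
    ?_ ?_ ?_ (fun m _ => card_le_two_mul_d_of_endpoint _ (S m) (hSend m)) hSe hSr he'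
  · intro m hm
    exact ⟨fun c => by have := hmain m hm c; linarith [this], fun c hc => hSa m hm c fun h => hc ((hSmem m c).1 h)⟩
  · -- the geometric leak: `c_R(m)·2d ≤ λ·g·θ^{J−m}`
    intro m hm
    have hJm : J - m = (J - 1 - m) + 1 := by omega
    have hgeo := s0_mul_pow_le (P := P) hL1 ha₀.le m (J - 1 - m)
    rw [show m + (J - 1 - m) = J - 1 by omega] at hgeo
    have hX : (0 : ℝ) < ((P.L : ℝ) ^ 2) ^ (J - 1 - m) := by positivity
    have hbr : lam * (2 * (P.d : ℝ) * (16 * (12 * (P.L : ℝ) * ρ) / ρ ^ 2 * (2 * (30 * (((P.d + 2) * P.L : ℕ) : ℝ) * (P.L : ℝ) ^ (J - 1) * (2 * ((P.d : ℝ) * (3 * (P.L : ℝ) ^ ((J - 1) + 1) - 1)) * a₀)))) * (P.L : ℝ) ^ (P.d + 1)) * (((P.L : ℝ) ^ 2)⁻¹) ^ (J - m) =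
        2 * (P.d : ℝ) * (16 * (12 * (P.L : ℝ) * ρ) / ρ ^ 2 * (2 * (30 * (((P.d + 2) * P.L : ℕ) : ℝ) * (P.L : ℝ) ^ (J - 1) * (2 * ((P.d : ℝ) * (3 * (P.L : ℝ) ^ ((J - 1) + 1) - 1)) * a₀)))) * ((((P.L : ℝ) ^ 2) ^ (J - 1 - m))⁻¹) := by
      rw [hJm, pow_succ, hlam, inv_pow]; field_simp; ring
    rw [hbr]
    have hκ : 0 ≤ 16 * (12 * (P.L : ℝ) * ρ) / ρ ^ 2 * 2 := by positivity
    have hcmp : (30 * (((P.d + 2) * P.L : ℕ) : ℝ) * (P.L : ℝ) ^ m * (2 * ((P.d : ℝ) * (3 * (P.L : ℝ) ^ (m + 1) - 1)) * a₀)) ≤ (30 * (((P.d + 2) * P.L : ℕ) : ℝ) * (P.L : ℝ) ^ (J - 1) * (2 * ((P.d : ℝ) * (3 * (P.L : ℝ) ^ ((J - 1) + 1) - 1)) * a₀)) * ((((P.L : ℝ) ^ 2) ^ (J - 1 - m))⁻¹) := by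
      rw [← div_eq_mul_inv, le_div_iff₀ hX]; exact hgeo
    have hd0 : (0 : ℝ) ≤ 2 * (P.d : ℝ) := by positivity
    have hmul := mul_le_mul_of_nonneg_left hcmp (mul_nonneg hd0 hκ)
    generalize hA : (30 * (((P.d + 2) * P.L : ℕ) : ℝ) * (P.L : ℝ) ^ m * (2 * ((P.d : ℝ) * (3 * (P.L : ℝ) ^ (m + 1) - 1)) * a₀)) = A at hmul ⊢
    generalize hB : (30 * (((P.d + 2) * P.L : ℕ) : ℝ) * (P.L : ℝ) ^ (J - 1) * (2 * ((P.d : ℝ) * (3 * (P.L : ℝ) ^ ((J - 1) + 1) - 1)) * a₀)) = Bv at hmul ⊢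
    generalize hY : (((P.L : ℝ) ^ 2) ^ (J - 1 - m))⁻¹ = Y at hmul ⊢
    push_cast
    have e1 : 16 * (12 * (P.L : ℝ) * ρ) / ρ ^ 2 * (2 * A) * (2 * (P.d : ℝ)) = 2 * (P.d : ℝ) * (16 * (12 * (P.L : ℝ) * ρ) / ρ ^ 2 * 2) * A := by ring
    have e2 : 2 * (P.d : ℝ) * (16 * (12 * (P.L : ℝ) * ρ) / ρ ^ 2 * (2 * Bv)) * Y = 2 * (P.d : ℝ) * (16 * (12 * (P.L : ℝ) * ρ) / ρ ^ 2 * 2) * (Bv * Y) := by ring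
    rw [e1, e2]
    exact hmul
  · -- the recursion of the leak
    intro m hm c _
    show a (m + 1) c - e (m + 1) c = Tf m (fun c' => a m c' - e m c') c + (T m (a m) c - Tf m (a m) c)
    rw [has, hes m]
    have hsub : Tf m (fun c' => a m c' - e m c') c = Tf m (a m) c - Tf m (e m) c := by
      simp only [hTf]
      exact conjTube_sub (transfUp (fun x => Unitary.toUnits (suIncl (axialT U₀ (embIter (m + 1) c.src) x)) : GaugeTransf P 0 (Matrix (Fin 2) (Fin 2) ℂ)ˣ) m) (emb c.src) (a m) (e m) c
    rw [hsub]; abel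
  · -- the tube letter `Θλ = 2·L·L^{−d}`
    intro m hm c _ w β hβ hw hwβ
    have h := norm_conjTube_le_of_endpoint (by omega : m + 1 ≤ P.m + P.K) (transfUp (fun x => Unitary.toUnits (suIncl (axialT U₀ (embIter (m + 1) c.src) x)) : GaugeTransf P 0 (Matrix (Fin 2) (Fin 2) ℂ)ˣ) m) (hû1 m c) (hû2 m c) (emb c.src)
      (iterBlockOf m b₀.src) (S m) (hSend m) w hw hβ hwβ c
    refine h.trans (le_of_eq ?_)
    rw [hlam]; ring
  · -- the leak letter `c_R(m)`
    intro m hm c _ w hw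
    exact norm_fderiv_chartField_apply_sub_conjTube_le_sum_of_plaqSmall (by omega) U₀ ha₀ hU (hbud₀ m hm) hρ0 hbudget (hs₀ρ m hm) (S m) w hw c

end SU2

end Summit.QuantumFields.YangMills.Theorems.Prop7CovLinearTowerProfile

end
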